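import Summits.KontsevichZagierPeriods.KontsevichZagierPeriods.Theorems.SoloInformedTelescopeReps
import HarnessLib
import HarnessLib.Audit

/-!
# SoloInformed — representations for `ζ(1,2) ≡ ζ(3)` in the formal period algebra

Solo programme `solo-KontsevichZagierPeriods-informed`, session s45 (PART XVI, the mixed Tate
sector). With `O = (0,1)³` and the descending open simplex `T = O ∩ {x₁ < x₀} ∩ {x₂ < x₁}`:

* cubical pieces of `R₂ = [O, 1/((1−yu)(1−yuw))]`:
  `Z₁₂ᶜ = [O, yu/((1−yu)(1−yuw))]` (value `ζ(1,2)`), `Z₃ᶜ = [O, 1/(1−yuw)]` (value `ζ(3)`);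
* simplicial (iterated-integral) representations
  `Z₁₂ˢ = [T, 1/(t₀(1−t₁)(1−t₂))] = ∫_{1>t₀>t₁>t₂>0} dt₀/t₀ · dt₁/(1−t₁) · dt₂/(1−t₂) = ζ(1,2)`,
  `Z₃ˢ = [T, 1/(t₀t₁(1−t₂))] = ζ(3)`, integrable by transport along `κ(x) = (x₀, x₀x₁, x₀x₁x₂)`;
* the two pieces `P₁ = R₁|_{w < yu}`, `P₂ = R₁|_{yu < w}` of `R₁ = [O ∩ {w<u}, 1/((1−yu)(1−w))]`
  and the maps `M₁ = (u, yu, w)`, `M₂ = (u, w, yu)` onto `T` (Jacobian `∓u`).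

The moves and the theorem `[Z₁₂ˢ] − [Z₃ˢ] ∈ KZ.relations` are in `SoloInformedZetaOneTwo`.

References: M. Kontsevich, D. Zagier, *Periods* (2001), §1.1–1.2 [KontsevichZagier2001].
-/

noncomputable section

open MeasureTheory Set MvPolynomial
open Literature.ModelTheory.ExponentialFields Literature.NumberTheory.Transcendental
open Literature.NumberTheory.Transcendental.KZ

namespace Summit.KontsevichZagierPeriods.KontsevichZagierPeriods.Theorems

/-! ## 1. The cubical pieces of `R₂` -/

/-- `yu/((1−yu)(1−yuw))`. -/
def soloInformedZ12c (x : Fin 3 → ℝ) : ℝ := x 0 * x 1 / ((1 - x 0 * x 1) * (1 - x 0 * x 1 * x 2))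
/-- `1/(1−yuw)`. -/
def soloInformedZ3c (x : Fin 3 → ℝ) : ℝ := 1 / (1 - x 0 * x 1 * x 2)

section cube
variable {x : Fin 3 → ℝ}

/-- `S = Z₁₂ᶜ + Z₃ᶜ` pointwise on the cube. -/
theorem soloInformedTelS_eq_Z12c_add_Z3c (hx : x ∈ soloInformedOpenCube 3) :
    soloInformedTelS x = soloInformedZ12c x + soloInformedZ3c x := by
  rw [soloInformedTelS, soloInformedZ12c, soloInformedZ3c]
  set a := 1 - x 0 * x 1 with ha_def
  set b := 1 - x 0 * x 1 * x 2 with hb_def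
  have ha : a ≠ 0 := (soloInformed_one_sub_yu_pos hx).ne'
  have hb : b ≠ 0 := (soloInformed_one_sub_yuw_pos hx).ne'
  field_simp
  rw [ha_def]; ring

/-- Auxiliary (ζ(1,2) = ζ(3)): `soloInformedZ12c_pos`. -/
theorem soloInformedZ12c_pos (hx : x ∈ soloInformedOpenCube 3) : 0 < soloInformedZ12c x :=
  div_pos (mul_pos (hx 0).1 (hx 1).1)
    (mul_pos (soloInformed_one_sub_yu_pos hx) (soloInformed_one_sub_yuw_pos hx))

/-- Auxiliary (ζ(1,2) = ζ(3)): `soloInformedZ3c_pos`. -/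
theorem soloInformedZ3c_pos (hx : x ∈ soloInformedOpenCube 3) : 0 < soloInformedZ3c x :=
  one_div_pos.2 (soloInformed_one_sub_yuw_pos hx)

/-- Auxiliary (ζ(1,2) = ζ(3)): `soloInformedZ12c_le_S`. -/
theorem soloInformedZ12c_le_S (hx : x ∈ soloInformedOpenCube 3) :
    soloInformedZ12c x ≤ soloInformedTelS x := by
  rw [soloInformedTelS_eq_Z12c_add_Z3c hx]; linarith [soloInformedZ3c_pos hx]

/-- Auxiliary (ζ(1,2) = ζ(3)): `soloInformedZ3c_le_S`. -/
theorem soloInformedZ3c_le_S (hx : x ∈ soloInformedOpenCube 3) :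
    soloInformedZ3c x ≤ soloInformedTelS x := by
  rw [soloInformedTelS_eq_Z12c_add_Z3c hx]; linarith [soloInformedZ12c_pos hx]

end cube

/-- Auxiliary (ζ(1,2) = ζ(3)): `soloInformed_continuousOn_Z12c`. -/
theorem soloInformed_continuousOn_Z12c : ContinuousOn soloInformedZ12c (soloInformedOpenCube 3) := by
  refine ContinuousOn.div (by fun_prop) (by fun_prop) fun x hx => ?_
  exact (mul_pos (soloInformed_one_sub_yu_pos hx) (soloInformed_one_sub_yuw_pos hx)).ne'

/-- Auxiliary (ζ(1,2) = ζ(3)): `soloInformed_continuousOn_Z3c`. -/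
theorem soloInformed_continuousOn_Z3c : ContinuousOn soloInformedZ3c (soloInformedOpenCube 3) :=
  ContinuousOn.div continuousOn_const (by fun_prop) fun _ hx => (soloInformed_one_sub_yuw_pos hx).ne'

/-- **`Z₁₂ᶜ = [O, yu/((1−yu)(1−yuw))]`** (`= Σ_{m<n} 1/(m n²) = ζ(1,2)`). -/
def soloInformedZ12cRep : IntegralRep 3 where
  domain := soloInformedOpenCube 3
  integrand := soloInformedZ12c
  isSemialgebraic_domain := isSemialgebraic_soloInformedOpenCube 3
  isSemialgebraicFunOn_integrand :=
    soloInformed_isSemialgebraicFunOn_quot3 (isSemialgebraic_soloInformedOpenCube 3) (X 0 * X 1)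
      ((1 - X 0 * X 1) * (1 - X 0 * X 1 * X 2)) _
      (fun x hx => by
        simpa using (mul_pos (soloInformed_one_sub_yu_pos hx) (soloInformed_one_sub_yuw_pos hx)).ne')
      fun x _ => by simp [soloInformedZ12c]
  integrableOn :=
    soloInformed_integrableOn_of_le_W3 soloInformed_measurableSet_openCube3 Subset.rfl
      soloInformed_continuousOn_Z12c soloInformedTelE2 soloInformedTelE2_lt_one 1 fun x hx => by
        rw [abs_of_pos (soloInformedZ12c_pos hx), one_mul]
        exact (soloInformedZ12c_le_S hx).trans (soloInformedTelS_le_W3 hx)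

/-- **`Z₃ᶜ = [O, 1/(1−yuw)]`** (`= ζ(3)`, Beukers' box integral). -/
def soloInformedZ3cRep : IntegralRep 3 where
  domain := soloInformedOpenCube 3
  integrand := soloInformedZ3c
  isSemialgebraic_domain := isSemialgebraic_soloInformedOpenCube 3
  isSemialgebraicFunOn_integrand :=
    soloInformed_isSemialgebraicFunOn_quot3 (isSemialgebraic_soloInformedOpenCube 3) 1
      (1 - X 0 * X 1 * X 2) _ (fun x hx => by simpa using (soloInformed_one_sub_yuw_pos hx).ne')
      fun x _ => by simp [soloInformedZ3c]
  integrableOn :=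
    soloInformed_integrableOn_of_le_W3 soloInformed_measurableSet_openCube3 Subset.rfl
      soloInformed_continuousOn_Z3c soloInformedTelE2 soloInformedTelE2_lt_one 1 fun x hx => by
        rw [abs_of_pos (soloInformedZ3c_pos hx), one_mul]
        exact (soloInformedZ3c_le_S hx).trans (soloInformedTelS_le_W3 hx)

/-! ## 2. The descending simplex and three monomial maps onto it -/

/-- `T = (0,1)³ ∩ {x₁ < x₀} ∩ {x₂ < x₁}` (the open simplex `1 > t₀ > t₁ > t₂ > 0`). -/
def soloInformedTelT : Set (Fin 3 → ℝ) :=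
  soloInformedOpenCube 3 ∩ ({x | x 1 < x 0} ∩ {x | x 2 < x 1})

/-- Auxiliary (ζ(1,2) = ζ(3)): `isSemialgebraic_soloInformedTelT`. -/
theorem isSemialgebraic_soloInformedTelT : IsSemialgebraic ℚ soloInformedTelT :=
  (isSemialgebraic_soloInformedOpenCube 3).inter
    ((soloInformed_isSemialgebraic_lt3' (X 1) (X 0) (fun x => x 1) (fun x => x 0) (fun x => by simp)
      fun x => by simp).inter
    (soloInformed_isSemialgebraic_lt3' (X 2) (X 1) (fun x => x 2) (fun x => x 1) (fun x => by simp)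
      fun x => by simp))

/-- A monomial-type map `x ↦ (aeval Pⱼ)` given by three coordinate formulas. -/
theorem soloInformed_polyMap3_apply (P : Fin 3 → MvPolynomial (Fin 3) ℚ) (x : Fin 3 → ℝ) (j : Fin 3) :
    soloInformedPolyMap P x j = aeval x (P j) := rfl

/-- `κ = (x₀, x₀x₁, x₀x₁x₂)`, `M₁ = (x₁, x₀x₁, x₂)`, `M₂ = (x₁, x₂, x₀x₁)`. -/
def soloInformedTelKapPoly : Fin 3 → MvPolynomial (Fin 3) ℚ := ![X 0, X 0 * X 1, X 0 * X 1 * X 2]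
/-- Auxiliary (ζ(1,2) = ζ(3)): `soloInformedTelM1Poly`. -/
def soloInformedTelM1Poly : Fin 3 → MvPolynomial (Fin 3) ℚ := ![X 1, X 0 * X 1, X 2]
/-- Auxiliary (ζ(1,2) = ζ(3)): `soloInformedTelM2Poly`. -/
def soloInformedTelM2Poly : Fin 3 → MvPolynomial (Fin 3) ℚ := ![X 1, X 2, X 0 * X 1]

/-- `κ`. -/
def soloInformedTelKap : (Fin 3 → ℝ) → Fin 3 → ℝ := soloInformedPolyMap soloInformedTelKapPoly
/-- `M₁`. -/
def soloInformedTelM1 : (Fin 3 → ℝ) → Fin 3 → ℝ := soloInformedPolyMap soloInformedTelM1Poly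
/-- `M₂`. -/
def soloInformedTelM2 : (Fin 3 → ℝ) → Fin 3 → ℝ := soloInformedPolyMap soloInformedTelM2Poly

/-- Auxiliary (ζ(1,2) = ζ(3)): `soloInformedTelKap_zero`. -/
@[simp] theorem soloInformedTelKap_zero (x : Fin 3 → ℝ) : soloInformedTelKap x 0 = x 0 := by
  simp [soloInformedTelKap, soloInformedTelKapPoly]
/-- Auxiliary (ζ(1,2) = ζ(3)): `soloInformedTelKap_one`. -/
@[simp] theorem soloInformedTelKap_one (x : Fin 3 → ℝ) : soloInformedTelKap x 1 = x 0 * x 1 := by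
  simp [soloInformedTelKap, soloInformedTelKapPoly]
/-- Auxiliary (ζ(1,2) = ζ(3)): `soloInformedTelKap_two`. -/
@[simp] theorem soloInformedTelKap_two (x : Fin 3 → ℝ) :
    soloInformedTelKap x 2 = x 0 * x 1 * x 2 := by
  simp [soloInformedTelKap, soloInformedTelKapPoly]
/-- Auxiliary (ζ(1,2) = ζ(3)): `soloInformedTelM1_zero`. -/
@[simp] theorem soloInformedTelM1_zero (x : Fin 3 → ℝ) : soloInformedTelM1 x 0 = x 1 := by
  simp [soloInformedTelM1, soloInformedTelM1Poly]
/-- Auxiliary (ζ(1,2) = ζ(3)): `soloInformedTelM1_one`. -/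
@[simp] theorem soloInformedTelM1_one (x : Fin 3 → ℝ) : soloInformedTelM1 x 1 = x 0 * x 1 := by
  simp [soloInformedTelM1, soloInformedTelM1Poly]
/-- Auxiliary (ζ(1,2) = ζ(3)): `soloInformedTelM1_two`. -/
@[simp] theorem soloInformedTelM1_two (x : Fin 3 → ℝ) : soloInformedTelM1 x 2 = x 2 := by
  simp [soloInformedTelM1, soloInformedTelM1Poly]
/-- Auxiliary (ζ(1,2) = ζ(3)): `soloInformedTelM2_zero`. -/
@[simp] theorem soloInformedTelM2_zero (x : Fin 3 → ℝ) : soloInformedTelM2 x 0 = x 1 := by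
  simp [soloInformedTelM2, soloInformedTelM2Poly]
/-- Auxiliary (ζ(1,2) = ζ(3)): `soloInformedTelM2_one`. -/
@[simp] theorem soloInformedTelM2_one (x : Fin 3 → ℝ) : soloInformedTelM2 x 1 = x 2 := by
  simp [soloInformedTelM2, soloInformedTelM2Poly]
/-- Auxiliary (ζ(1,2) = ζ(3)): `soloInformedTelM2_two`. -/
@[simp] theorem soloInformedTelM2_two (x : Fin 3 → ℝ) : soloInformedTelM2 x 2 = x 0 * x 1 := by
  simp [soloInformedTelM2, soloInformedTelM2Poly]

/-- Jacobians: `det J_κ = x₀²x₁`, `det J_{M₁} = −x₁`, `det J_{M₂} = x₁`. -/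
theorem soloInformed_det_telKap (x : Fin 3 → ℝ) :
    (soloInformedJacCLM soloInformedTelKapPoly x).det = x 0 * x 0 * x 1 := by
  rw [soloInformed_det_jacCLM, Matrix.det_fin_three]
  simp [soloInformedTelKapPoly, soloInformedJacMat_apply, pderiv_X]; ring

/-- Auxiliary (ζ(1,2) = ζ(3)): `soloInformed_det_telM1`. -/
theorem soloInformed_det_telM1 (x : Fin 3 → ℝ) :
    (soloInformedJacCLM soloInformedTelM1Poly x).det = -x 1 := by
  rw [soloInformed_det_jacCLM, Matrix.det_fin_three]
  simp [soloInformedTelM1Poly, soloInformedJacMat_apply, pderiv_X]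

/-- Auxiliary (ζ(1,2) = ζ(3)): `soloInformed_det_telM2`. -/
theorem soloInformed_det_telM2 (x : Fin 3 → ℝ) :
    (soloInformedJacCLM soloInformedTelM2Poly x).det = x 1 := by
  rw [soloInformed_det_jacCLM, Matrix.det_fin_three]
  simp [soloInformedTelM2Poly, soloInformedJacMat_apply, pderiv_X]

/-- `κ` is injective on the cube and maps it onto `T`. -/
theorem soloInformed_injOn_telKap : InjOn soloInformedTelKap (soloInformedOpenCube 3) := by
  intro x hx x' hx' h
  have h0 : x 0 = x' 0 := by simpa using congr_fun h 0
  have h1' : x 0 * x 1 = x' 0 * x' 1 := by simpa using congr_fun h 1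
  have h2' : x 0 * x 1 * x 2 = x' 0 * x' 1 * x' 2 := by simpa using congr_fun h 2
  have h1 : x 1 = x' 1 := by
    rw [← h0] at h1'; exact mul_left_cancel₀ (hx 0).1.ne' h1'
  have h2 : x 2 = x' 2 := by
    rw [← h0, ← h1] at h2'; exact mul_left_cancel₀ (mul_pos (hx 0).1 (hx 1).1).ne' h2'
  ext j; fin_cases j
  · exact h0
  · exact h1
  · exact h2

/-- Auxiliary (ζ(1,2) = ζ(3)): `soloInformed_image_telKap`. -/
theorem soloInformed_image_telKap : soloInformedTelKap '' soloInformedOpenCube 3 = soloInformedTelT := by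
  refine Subset.antisymm ?_ fun t ht => ?_
  · rintro _ ⟨x, hx, rfl⟩
    have h0 := hx 0; have h1 := hx 1; have h2 := hx 2
    have h01 := mul_pos h0.1 h1.1
    refine ⟨fun j => ?_, ?_, ?_⟩
    · fin_cases j
      · simpa using h0
      · show 0 < soloInformedTelKap x 1 ∧ soloInformedTelKap x 1 < 1
        rw [soloInformedTelKap_one]; exact ⟨h01, by nlinarith⟩
      · show 0 < soloInformedTelKap x 2 ∧ soloInformedTelKap x 2 < 1
        rw [soloInformedTelKap_two]; exact ⟨mul_pos h01 h2.1, by nlinarith [mul_pos h01 h2.1]⟩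
    · show soloInformedTelKap x 1 < soloInformedTelKap x 0
      rw [soloInformedTelKap_one, soloInformedTelKap_zero]; nlinarith
    · show soloInformedTelKap x 2 < soloInformedTelKap x 1
      rw [soloInformedTelKap_one, soloInformedTelKap_two]; nlinarith
  · have h0 := ht.1 0; have h1 := ht.1 1; have h2 := ht.1 2
    have h10 : t 1 < t 0 := ht.2.1
    have h21 : t 2 < t 1 := ht.2.2
    refine ⟨![t 0, t 1 / t 0, t 2 / t 1], fun j => ?_, ?_⟩
    · fin_cases j
      · simpa using h0
      · simpa using And.intro (div_pos h1.1 h0.1) ((div_lt_one h0.1).2 h10)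
      · simpa using And.intro (div_pos h2.1 h1.1) ((div_lt_one h1.1).2 h21)
    · ext j; fin_cases j
      · simp
      · simp [mul_div_cancel₀ _ h0.1.ne']
      · simp [mul_div_cancel₀ _ h0.1.ne', mul_div_cancel₀ _ h1.1.ne']

/-! ## 3. The pieces of `R₁` and their charts -/

/-- `P₁`-domain `O ∩ {w < yu}` and `P₂`-domain `O ∩ {yu < w} ∩ {w < u}`. -/
def soloInformedTelP1D : Set (Fin 3 → ℝ) := soloInformedOpenCube 3 ∩ {x | x 2 < x 0 * x 1}
/-- Auxiliary (ζ(1,2) = ζ(3)): `soloInformedTelP2D`. -/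
def soloInformedTelP2D : Set (Fin 3 → ℝ) :=
  soloInformedOpenCube 3 ∩ ({x | x 0 * x 1 < x 2} ∩ {x | x 2 < x 1})

/-- Auxiliary (ζ(1,2) = ζ(3)): `isSemialgebraic_soloInformedTelP1D`. -/
theorem isSemialgebraic_soloInformedTelP1D : IsSemialgebraic ℚ soloInformedTelP1D :=
  (isSemialgebraic_soloInformedOpenCube 3).inter
    (soloInformed_isSemialgebraic_lt3' (X 2) (X 0 * X 1) (fun x => x 2) (fun x => x 0 * x 1)
      (fun x => by simp) fun x => by simp)

/-- Auxiliary (ζ(1,2) = ζ(3)): `isSemialgebraic_soloInformedTelP2D`. -/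
theorem isSemialgebraic_soloInformedTelP2D : IsSemialgebraic ℚ soloInformedTelP2D :=
  (isSemialgebraic_soloInformedOpenCube 3).inter
    ((soloInformed_isSemialgebraic_lt3' (X 0 * X 1) (X 2) (fun x => x 0 * x 1) (fun x => x 2)
      (fun x => by simp) fun x => by simp).inter
    (soloInformed_isSemialgebraic_lt3' (X 2) (X 1) (fun x => x 2) (fun x => x 1) (fun x => by simp)
      fun x => by simp))

/-- Auxiliary (ζ(1,2) = ζ(3)): `soloInformedTelP1D_subset`. -/
theorem soloInformedTelP1D_subset : soloInformedTelP1D ⊆ soloInformedTelD1 := fun x hx =>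
  ⟨hx.1, by
    have h0 := hx.1 0; have h1 := hx.1 1
    have h : x 2 < x 0 * x 1 := hx.2
    show x 2 < x 1
    nlinarith⟩

/-- Auxiliary (ζ(1,2) = ζ(3)): `soloInformedTelP2D_subset`. -/
theorem soloInformedTelP2D_subset : soloInformedTelP2D ⊆ soloInformedTelD1 := fun _ hx =>
  ⟨hx.1, hx.2.2⟩

/-- `P₁ = R₁|_{w < yu}`, `P₂ = R₁|_{yu < w}`. -/
def soloInformedTelP1 : IntegralRep 3 :=
  soloInformedTelR1.restrict soloInformedTelP1D isSemialgebraic_soloInformedTelP1D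
    soloInformedTelP1D_subset
/-- Auxiliary (ζ(1,2) = ζ(3)): `soloInformedTelP2`. -/
def soloInformedTelP2 : IntegralRep 3 :=
  soloInformedTelR1.restrict soloInformedTelP2D isSemialgebraic_soloInformedTelP2D
    soloInformedTelP2D_subset

/-- `M₁` is injective on `P₁`'s domain and maps it onto `T`. -/
theorem soloInformed_injOn_telM1 : InjOn soloInformedTelM1 (soloInformedOpenCube 3) := by
  intro x hx x' hx' h
  have h1 : x 1 = x' 1 := by simpa using congr_fun h 0
  have h0' : x 0 * x 1 = x' 0 * x' 1 := by simpa using congr_fun h 1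
  have h2 : x 2 = x' 2 := by simpa using congr_fun h 2
  have h0 : x 0 = x' 0 := by
    rw [← h1] at h0'; exact mul_right_cancel₀ (hx 1).1.ne' h0'
  ext j; fin_cases j
  · exact h0
  · exact h1
  · exact h2

/-- Auxiliary (ζ(1,2) = ζ(3)): `soloInformed_image_telM1`. -/
theorem soloInformed_image_telM1 : soloInformedTelM1 '' soloInformedTelP1D = soloInformedTelT := by
  refine Subset.antisymm ?_ fun t ht => ?_
  · rintro _ ⟨x, hx, rfl⟩
    have h0 := hx.1 0; have h1 := hx.1 1; have h2 := hx.1 2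
    have hw : x 2 < x 0 * x 1 := hx.2
    have h01 := mul_pos h0.1 h1.1
    refine ⟨fun j => ?_, ?_, ?_⟩
    · fin_cases j
      · simpa using h1
      · show 0 < soloInformedTelM1 x 1 ∧ soloInformedTelM1 x 1 < 1
        rw [soloInformedTelM1_one]; exact ⟨h01, by nlinarith⟩
      · simpa using h2
    · show soloInformedTelM1 x 1 < soloInformedTelM1 x 0
      rw [soloInformedTelM1_one, soloInformedTelM1_zero]; nlinarith
    · show soloInformedTelM1 x 2 < soloInformedTelM1 x 1
      rw [soloInformedTelM1_one, soloInformedTelM1_two]; exact hw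
  · have h0 := ht.1 0; have h1 := ht.1 1; have h2 := ht.1 2
    have h10 : t 1 < t 0 := ht.2.1
    have h21 : t 2 < t 1 := ht.2.2
    refine ⟨![t 1 / t 0, t 0, t 2], ⟨fun j => ?_, ?_⟩, ?_⟩
    · fin_cases j
      · simpa using And.intro (div_pos h1.1 h0.1) ((div_lt_one h0.1).2 h10)
      · simpa using h0
      · simpa using h2
    · show (![t 1 / t 0, t 0, t 2] : Fin 3 → ℝ) 2 <
        (![t 1 / t 0, t 0, t 2] : Fin 3 → ℝ) 0 * (![t 1 / t 0, t 0, t 2] : Fin 3 → ℝ) 1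
      simp [div_mul_cancel₀ _ h0.1.ne', h21]
    · ext j; fin_cases j
      · simp
      · simp [div_mul_cancel₀ _ h0.1.ne']
      · simp

/-- `M₂` is injective on the cube and maps `P₂`'s domain onto `T`. -/
theorem soloInformed_injOn_telM2 : InjOn soloInformedTelM2 (soloInformedOpenCube 3) := by
  intro x hx x' hx' h
  have h1 : x 1 = x' 1 := by simpa using congr_fun h 0
  have h2 : x 2 = x' 2 := by simpa using congr_fun h 1
  have h0' : x 0 * x 1 = x' 0 * x' 1 := by simpa using congr_fun h 2
  have h0 : x 0 = x' 0 := by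
    rw [← h1] at h0'; exact mul_right_cancel₀ (hx 1).1.ne' h0'
  ext j; fin_cases j
  · exact h0
  · exact h1
  · exact h2

/-- Auxiliary (ζ(1,2) = ζ(3)): `soloInformed_image_telM2`. -/
theorem soloInformed_image_telM2 : soloInformedTelM2 '' soloInformedTelP2D = soloInformedTelT := by
  refine Subset.antisymm ?_ fun t ht => ?_
  · rintro _ ⟨x, hx, rfl⟩
    have h0 := hx.1 0; have h1 := hx.1 1; have h2 := hx.1 2
    have hlo : x 0 * x 1 < x 2 := hx.2.1
    have hhi : x 2 < x 1 := hx.2.2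
    have h01 := mul_pos h0.1 h1.1
    refine ⟨fun j => ?_, ?_, ?_⟩
    · fin_cases j
      · simpa using h1
      · simpa using h2
      · show 0 < soloInformedTelM2 x 2 ∧ soloInformedTelM2 x 2 < 1
        rw [soloInformedTelM2_two]; exact ⟨h01, by nlinarith⟩
    · show soloInformedTelM2 x 1 < soloInformedTelM2 x 0
      rw [soloInformedTelM2_one, soloInformedTelM2_zero]; exact hhi
    · show soloInformedTelM2 x 2 < soloInformedTelM2 x 1
      rw [soloInformedTelM2_one, soloInformedTelM2_two]; exact hlo
  · have h0 := ht.1 0; have h1 := ht.1 1; have h2 := ht.1 2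
    have h10 : t 1 < t 0 := ht.2.1
    have h21 : t 2 < t 1 := ht.2.2
    refine ⟨![t 2 / t 0, t 0, t 1], ⟨fun j => ?_, ?_, ?_⟩, ?_⟩
    · fin_cases j
      · simpa using And.intro (div_pos h2.1 h0.1) ((div_lt_one h0.1).2 (h21.trans h10))
      · simpa using h0
      · simpa using h1
    · show (![t 2 / t 0, t 0, t 1] : Fin 3 → ℝ) 0 * (![t 2 / t 0, t 0, t 1] : Fin 3 → ℝ) 1 <
        (![t 2 / t 0, t 0, t 1] : Fin 3 → ℝ) 2
      simp [div_mul_cancel₀ _ h0.1.ne', h21]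
    · show (![t 2 / t 0, t 0, t 1] : Fin 3 → ℝ) 2 < (![t 2 / t 0, t 0, t 1] : Fin 3 → ℝ) 1
      simpa using h10
    · ext j; fin_cases j
      · simp
      · simp
      · simp [div_mul_cancel₀ _ h0.1.ne']

end Summit.KontsevichZagierPeriods.KontsevichZagierPeriods.Theorems
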